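import Literature.Analysis.FluidPDE.ExponentialMixingSlowDissipation
import HarnessLib

/-!
# Cooperman–Iyer–Rowan–Son 2025: proved bookkeeping for the typed statements

Companion (theorems only, no definitions, no named facts) of `ExponentialMixingSlowDissipation.lean`
(arXiv:2507.21305v2, [`CoopermanIyerRowanSon2025`]):

* the dissipation-time inequalities `CIRS2025.DissipationTimeGE/LE` (exact `inf` renderings of
  `t^s_dis ≥ τ` / `t^s_dis ≤ τ` over `Rowan2024.HalvesNorm`) are monotone in the threshold, a halving
  time witnesses an upper bound, and a lower bound `τ ≤ t^s_dis` is consistent with an upper bound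
  `t^s_dis ≤ τ'` only if `τ ≤ τ'` (`DissipationTimeLE.ge_le`);
* the mixing bounds (1.8) are monotone in the rate (`MixingBoundAt.mono`, `MixingRateBound.mono`);
* **Corollary 1.5 for time-homogeneous rates** (`p = 0`): a bounded, uniformly `L`-Lipschitz,
  divergence-free flow mixing with rate `De^{-γt}` has
  `t⁰_dis(u,κ) ≤ C₁(L+1)(1 + ((log D)² + (log κ)² + C₂)/γ²)` — the `O(|log κ|²)` dissipation time of
  uniformly Lipschitz exponential mixers (Feng–Iyer 2019; the source, p. 2: "if `u^κ` is `C¹` and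
  exponentially mixing uniformly in `κ` then `t_dis ≤ C|log κ|²`")
  (`CoopermanIyerRowanSon2025_cor15.timeHomogeneous`).

## References

* W. Cooperman, G. Iyer, K. Rowan, S. Son, arXiv:2507.21305v2, §1.1 p. 1 (dissipation time), (1.8)
  p. 3, Cor. 1.5 p. 5. [`CoopermanIyerRowanSon2025`]
* Y. Feng, G. Iyer, Nonlinearity 32 (2019) 1810–1851. [`FengIyer2019`]
-/

open MeasureTheory Set Filter Topology Function Metric
open scoped ENNReal NNReal

namespace Literature.Analysis.FluidPDE

noncomputable section

open Literature.Analysis.FunctionSpaces Rowan2024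

namespace CIRS2025

variable {d : Type*} [Fintype d]
variable {κ : ℝ} {u : ℝ → UnitAddTorus d → EuclideanSpace ℝ d} {s : ℝ}

/-- `t^s_dis ≥ τ` is vacuous for `τ ≤ 0`. [cite: CoopermanIyerRowanSon2025, §1.1 p. 1] -/
theorem dissipationTimeGE_of_nonpos {τ : ℝ} (hτ : τ ≤ 0) : DissipationTimeGE κ u s τ :=
  fun _ ht htτ => absurd (ht.trans_lt htτ) (not_lt.2 hτ)

/-- `t^s_dis ≥ τ` and `τ' ≤ τ` give `t^s_dis ≥ τ'`. [cite: CoopermanIyerRowanSon2025, §1.1 p. 1] -/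
theorem DissipationTimeGE.mono {τ τ' : ℝ} (h : DissipationTimeGE κ u s τ) (hτ : τ' ≤ τ) :
    DissipationTimeGE κ u s τ' :=
  fun t ht htτ => h t ht (htτ.trans_le hτ)

/-- `t^s_dis ≤ τ` and `τ ≤ τ'` give `t^s_dis ≤ τ'`. [cite: CoopermanIyerRowanSon2025, §1.1 p. 1] -/
theorem DissipationTimeLE.mono {τ τ' : ℝ} (h : DissipationTimeLE κ u s τ) (hτ : τ ≤ τ') :
    DissipationTimeLE κ u s τ' :=
  fun τ'' hτ'' => h τ'' (hτ.trans_lt hτ'')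

/-- A halving time `t ∈ [0,τ]` (`‖Φ^{u,κ}_{s,s+t}‖ ≤ 1/2`) witnesses `t^s_dis ≤ τ`.
[cite: CoopermanIyerRowanSon2025, §1.1 p. 1] -/
theorem dissipationTimeLE_of_halvesNorm {t τ : ℝ} (ht : 0 ≤ t) (htτ : t ≤ τ)
    (h : HalvesNorm κ u s (s + t)) : DissipationTimeLE κ u s τ :=
  fun _ hτ' => ⟨t, ht, htτ.trans hτ'.le, h⟩

/-- Consistency of the two renderings: `t^s_dis ≤ τ'` and `t^s_dis ≥ τ` force `τ ≤ τ'`.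
[cite: CoopermanIyerRowanSon2025, §1.1 p. 1] -/
theorem DissipationTimeLE.ge_le {τ τ' : ℝ} (hle : DissipationTimeLE κ u s τ')
    (hge : DissipationTimeGE κ u s τ) : τ ≤ τ' := by
  by_contra hlt
  obtain ⟨t, ht0, ht, hhalf⟩ := hle ((τ' + τ) / 2) (by linarith [lt_of_not_ge hlt])
  exact hge t ht0 (by linarith [lt_of_not_ge hlt]) hhalf

/-- The mixing bound (1.8) is monotone in the constant. [cite: CoopermanIyerRowanSon2025, §1.2 (1.8) p. 3] -/
theorem MixingBoundAt.mono {t r r' : ℝ} (h : MixingBoundAt u s t r) (hr : r ≤ r') :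
    MixingBoundAt u s t r' := by
  intro ϕs hϕs hmean hH1 T ϕ htT hsol hcont
  refine (h ϕs hϕs hmean hH1 T ϕ htT hsol hcont).trans ?_
  gcongr

/-- "Mixing with rate `h`" is monotone in the rate function (a rate is an upper bound).
[cite: CoopermanIyerRowanSon2025, §1.2 (1.8) p. 3] -/
theorem MixingRateBound.mono {h h' : ℝ → ℝ → ℝ} (hu : MixingRateBound u h)
    (hh : ∀ s t : ℝ, 0 ≤ s → 0 ≤ t → h s t ≤ h' s t) : MixingRateBound u h' :=
  fun s t hs ht => (hu s t hs ht).mono (hh s t hs ht)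

end CIRS2025

open CIRS2025

variable {d : Type*} [Fintype d]

/-- **Corollary 1.5 for time-homogeneous exponential mixers** (`p = 0`): from
`CoopermanIyerRowanSon2025_cor15` there are `C₁ > 0`, `C₂ ≥ 0` such that every bounded, space–time
measurable velocity field on `[0,∞) × T^d`, weakly divergence free and `L`-Lipschitz in space at
every `t ≥ 0`, which is mixing with the time-homogeneous rate `h(s,t) = De^{-γt}` (`D, γ > 0`), has
`t⁰_dis(u,κ) ≤ C₁(L+1)(1 + ((log D)² + (log κ)² + C₂)/γ²)` for every `κ > 0` — the `O(|log κ|²)`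
dissipation time of uniformly Lipschitz exponential mixers (p. 2, after (1.2); Feng–Iyer 2019).
(`De^{-γt} ≤ D(1 + s⁰)e^{-γt}`, and the `(p/γ)⁴` term vanishes.)
[cite: CoopermanIyerRowanSon2025, Cor. 1.5 p. 5 and p. 2] -/
theorem CoopermanIyerRowanSon2025_cor15.timeHomogeneous
    (hcor : CoopermanIyerRowanSon2025_cor15 (d := d)) :
    ∃ C₁ C₂ : ℝ, 0 < C₁ ∧ 0 ≤ C₂ ∧
      ∀ (u : ℝ → UnitAddTorus d → EuclideanSpace ℝ d) (M L D γ : ℝ),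
        AEStronglyMeasurable (Torus.stLift u) volume →
        (∀ t : ℝ, 0 ≤ t → Torus.IsWeaklyDivFree (u t)) →
        (∀ t : ℝ, 0 ≤ t → ∀ x : UnitAddTorus d, ‖u t x‖ ≤ M) →
        0 ≤ L → (∀ t : ℝ, 0 ≤ t → ∀ x y : UnitAddTorus d, ‖u t x - u t y‖ ≤ L * dist x y) →
        0 < D → 0 < γ →
        MixingRateBound u (fun _ t => D * Real.exp (-(γ * t))) →
        ∀ κ : ℝ, 0 < κ →
          DissipationTimeLE κ u 0
            (C₁ * (L + 1) * (1 + (Real.log D ^ 2 + Real.log κ ^ 2 + C₂) / γ ^ 2)) := by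
  obtain ⟨C₁, C₂, hC₁, hC₂, h⟩ := hcor
  refine ⟨C₁, C₂, hC₁, hC₂, fun u M L D γ hmeas hdiv hbdd hL hlip hD hγ hmix κ hκ => ?_⟩
  have hmix' : MixingRateBound u (fun s t => D * (1 + s ^ (0 : ℝ)) * Real.exp (-(γ * t))) := by
    refine hmix.mono fun s t _ _ => ?_
    rw [Real.rpow_zero]
    have := Real.exp_pos (-(γ * t))
    nlinarith
  have := h u M L D 0 γ hmeas hdiv hbdd hL hlip hD le_rfl hγ hmix' κ hκ
  simpa [zero_div] using this

end

end Literature.Analysis.FluidPDE
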